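/-
Copyright (c) 2026 the pub-hodgecm-mathlib formalisation cell (harness21).  Prover seat hodgecm-mathlib-LH4-p11 (g4), req620 Track A «(D-RAM) FOUR-FRAME» squad: dealer LH4-plan (g12)
WORD #22 (2) «GO — (R-15) ★ TWIN OF TIER-0 ROW `stub_rows_unit0` IN HYPOTHESIS FORM» over ★ #11S and the ★ DEEP-THRESHOLD BRIDGE (p857235 ∕ p857243; REF5 (g23) R5-142).
2026-09-04.
-/
import Summits.HodgeConjecture.HodgeConjecture.Theorems.F0P3cDyRamAnchorRowsOfFourFrameLawsR        -- ★ #11S (F0P3a-p01 (g30) ∕ B-p08 (g41), RC-1): `anchorRows_of_fourFrameLawsS` — the law socket proper; brings ★ №1-R, №2b, №2c-R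
import Summits.HodgeConjecture.HodgeConjecture.Theorems.F0P3cDyRamFourFrameLawsDeepThreshold       -- ★ p857235 (this seat): `lawsAtR_deep_of_ofRecordR2`, `fourFrameTransferFactorS_any`; brings ★ p857042, ★ №1-R2, ★ ΩR
import Summits.HodgeConjecture.HodgeConjecture.Theorems.F0P3cDyRamHSideAnchorRowsDeepThreshold     -- ★ p857243 (this seat): `hSideAnchorRowsR_deep_of_depthOfRecord`
import Summits.HodgeConjecture.HodgeConjecture.Theorems.F0P3cDyRamFourFramePieces                  -- ★ DEFS №3 p854653: `PieceRowsWild`, `gselStar`, `pieceUnit0`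
import Summits.HodgeConjecture.HodgeConjecture.Theorems.F0P3cDyRamWildPlaceDatum                   -- ★ #12 p854601 (LH4-p02): `exists_isRamifiedQuadraticDatum_of_placesOver`
import Summits.HodgeConjecture.HodgeConjecture.Theorems.F0P3cDyRamPieceCountDictionaryUnit0       -- ★ (B-p08 (g41)): brings ★ `isSelfDualLattice_stdLattice_three_of_v`, ★ `mem_localIntegralLevel_iff_of_smul_eq`, ★ `mapGL_stdLattice_eq_iff_mem_glInt` (the root anchor `𝒪_w³` ∕ `K`)
import Literature.NumberTheory.Automorphic.AdicCompletionIntegerSpellings                       -- ★ `isUnit_two_valuationInteger_of_isUnit_two`: the `ValuativeRel` ∕ `Valued` spellings of `2 ∈ 𝒪[K_w]^×`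
import HarnessLib

/-!
# Crux `H413`, line LH4 «(D-RAM) FOUR-FRAME» road — THE (R-15) ★ TWIN OF THE TIER-0 ROW `stub_rows_unit0`, IN HYPOTHESIS FORM:
# `FourFrameLawsWildOfRecordR2 omegaR → HSideAnchorRowsR depthOfRecord tauOfRecord 0 → AnchorCountDictionary 0 → PieceRowsWild gselStar 0`

Cell `hodgecm-mathlib` (D-0151), FLOOR 0, crux item H413 = `stmt-HodgeConjecture-24833`, route of record `HCCMUnconditional`; squad F0∕P3c∕LH4 (req618∕req620); helper lane
`--supports stmt-HodgeConjecture-24833 --as helper` (count-neutral).  THEOREMS ONLY (no `def`, no instance, no notation, no `sorry`, default heartbeats).  Consumer: the tier-0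
line `Cruxes/H413/Lines/F0_P3c_DyRamFourFrame.lean`, registered stub `F0P3cDyRamFourFrame.stub_rows_unit0 : PieceRowsWild gselStar 0` (the three population rows of the type-0
anchor `1_K` near `1` at every WILD ramified non-split place), whose pay line — CUT ONLY ON THE HEIR LEAD's WORD (dealer WORD #22 (2)(c)) — would read
`stub_rows_unit0 := pieceRowsWild_gselStar_zero_of ‹U3 export› ‹U2H unit-0 export› ‹U2G (D-G) export›` (the U4 `piecePropsWild_of` pattern).

THE THREE HYPOTHESES ARE THE UNITS' EXPORTS, BY NAME (tied `rfl` on types in the tie probe posted with this file):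
* `hU3 : FourFrameLawsWildOfRecordR2 omegaR` — unit U3's CLOSED export `F0P3cDyRamFourFrameU3.u3_fourFrameLawsWildOfRecordR2` (U3 ED. 15, sorry-free, TRIO): the Ω-aware re-cut
  fenced laws (S)At ∧ (K-ABS-R)At ∧ (K-SGN-R2)At at `(omegaR, depthOfRecord, tauOfRecord)` at every complete datum.
* `hDH : HSideAnchorRowsR depthOfRecord tauOfRecord 0` — unit U2H's export `F0P3cDyRamFourFrameU2H.stub_U2H_hSideAnchorRows_unit0` (trio ∪ `sorryAx` through the ONE open tier-1
  row (ρ2b′-X) `stub_U2H_fixedPointCensus_typeTwo_unit0` :418, via `stub_U2H_rowsR_hFamily_unit0`).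
* `hDG : AnchorCountDictionary 0` — unit U2G's export `F0P3cDyRamFourFrame.U2GCensus.unitTwoG_anchorCountDictionary_zero` (★ p854635, TRIO).

THE PROOF (REF5 (g23) R5-142 recipe «DEEP-THRESHOLD BRIDGE», ★ p857235 ∕ p857243).  At a wild place `w ∣ v` of `PieceRowsWild`'s `∀`: the residue field of `L_w` is finite
(`Fintype.ofFinite`); ★ #12 gives the datum exponents `(d, t_E)` with `IsRamifiedQuadraticDatum σ_w ϖ d t_E`; `|2|_w < 1` from `¬ IsUnit 2`; the skew element `δ := ϖ − σ_w ϖ ≠ 0`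
(`|δ| = |ϖ|^d`).  RAISE THE THRESHOLD to `N₀' d' := max (depthOfRecord d') (2 d' − 1 + t_E)`: ★ `lawsAtR_deep_of_ofRecordR2 hU3` delivers ★ №1-R's three cuts (S)At, (K-ABS-R)At,
(K-SGN-R)At at `N₀'` (there `Ω ≡ 1` on every read row — covered place or not), ★ `fourFrameTransferFactorS_any shiftR N₀'` delivers (D-CΔ), ★ `hSideAnchorRowsR_deep_of_depthOfRecord`
weakens `hDH` to `N₀'` (antitone), and `hDG` is threshold-free.  Then ★ #11S `anchorRows_of_fourFrameLawsS shiftR` at the ROOT ANCHOR `N := 𝒪_w³` (a type-0 vertex, ★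
`isSelfDualLattice_stdLattice_three_of_v`), `K_0 := K = cmLocalIntegralLevel` (its stabiliser: ★ `mem_localIntegralLevel_iff_of_smul_eq` + ★ `mapGL_stdLattice_eq_iff_mem_glInt`) and
`g := gselStar 0 = pieceUnit0 = 𝟙_K` (`rfl`) IS the body of `PieceRowsWild gselStar 0` at this place — the `∃ V ∈ 𝓝 1` of each row absorbs the deeper threshold.  No `(d, t)` case
split, no Ω in any socket, no covered-set guard.

WHAT IS PROVED.
* `v_two_lt_one_of_not_isUnit_two` — `¬ IsUnit (2 : Valued.integer K) → |2| < 1` (10 lines of valuation algebra; the U3 Lines module has the same lemma, not importable here);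
  the place binder `¬ IsUnit (2 : 𝒪[L_w])` is in the `ValuativeRel` spelling and crosses over by ★ `isUnit_two_valuationInteger_of_isUnit_two`.
* `pieceRowsWild_gselStar_zero_of (hU3) (hDH) (hDG) : PieceRowsWild gselStar 0` — THE (R-15) TWIN.
HONEST LABEL.  Count-neutral (`--supports`): a composition over ★ files with the three unit exports as HYPOTHESES — it pays nothing by itself; the tier-0 row `stub_rows_unit0`
becomes sorry-free exactly when U2H (ρ2b′-X) :418 lands (the only non-★ leaf under `hDH`); rows `transvPlus ∕ transvMinus ∕ regular` are NOT touched; `HC_CM` is proved only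
modulo the 7 printed citations (2 remaining named inputs: hLiu418 = `stmt-HodgeConjecture-24832`, h413 = `stmt-HodgeConjecture-24833`) until rung 0 closes.

## References
* [Rogawski1990] J. D. Rogawski, *Automorphic Representations of Unitary Groups in Three Variables*, Ann. of Math. Stud. 123 (1990), §4.9 Prop. 4.9.1 p. 55; §8.1 Prop. 8.1.2 p. 114.
* [LanglandsShelstad1987] R. P. Langlands, D. Shelstad, *On the definition of transfer factors*, Math. Ann. 278 (1987), §1.3, §3.
* [Kottwitz1986BaseChangeUnits] R. E. Kottwitz, *Base change for unit elements of Hecke algebras*, Compositio Math. 60 (1986), §1 pp. 240–241.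
-/

set_option autoImplicit false

noncomputable section

namespace Summit.HodgeConjecture.HodgeConjecture.Cruxes.H413.F0P3cDyRamPieceRowsWildUnit0OfExports

open MeasureTheory Measure NumberField IsDedekindDomain Topology Filter
open Literature.NumberTheory.Automorphic Literature.NumberTheory.Automorphic.UnitaryGroup Literature.NumberTheory.Automorphic.IntegralReduction
open Literature.NumberTheory.Automorphic.UnitaryLatticeTree Literature.NumberTheory.Automorphic.HermitianLattice
open Literature.NumberTheory.Rogawski1990 Literature.NumberTheory.GaloisRepresentations
open Literature.MeasureTheory.Group (descConj)
open Literature.NumberTheory.Automorphic.UnitaryThreeFourFrame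
open scoped Matrix MatrixGroups Classical ValuativeRel WithZero Valued
open Summit.HodgeConjecture.HodgeConjecture.Cruxes.H413.F0P3cDyRamFourFrameLawDefs
open Summit.HodgeConjecture.HodgeConjecture.Cruxes.H413.F0P3cDyRamFourFrameLawDefsR
open Summit.HodgeConjecture.HodgeConjecture.Cruxes.H413.F0P3cDyRamFourFrameLawDefsR2
open Summit.HodgeConjecture.HodgeConjecture.Cruxes.H413.F0P3cDyRamOmegaRDefs
open Summit.HodgeConjecture.HodgeConjecture.Cruxes.H413.F0P3cDyRamFourFrameDictionaryDefs
open Summit.HodgeConjecture.HodgeConjecture.Cruxes.H413.F0P3cDyRamFourFrameHSideDefs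
open Summit.HodgeConjecture.HodgeConjecture.Cruxes.H413.F0P3cDyRamFourFrameHSideDefsR
open Summit.HodgeConjecture.HodgeConjecture.Cruxes.H413.F0P3cDyRamFourFramePieces
open Summit.HodgeConjecture.HodgeConjecture.Cruxes.H413.F0P3cDyRamAnchorRowsOfFourFrameLawsR
open Summit.HodgeConjecture.HodgeConjecture.Cruxes.H413.F0P3cDyRamFourFrameLawsDeepThreshold
open Summit.HodgeConjecture.HodgeConjecture.Cruxes.H413.F0P3cDyRamHSideAnchorRowsDeepThreshold
open Summit.HodgeConjecture.HodgeConjecture.Cruxes.H413.F0P3cDyRamWildPlaceDatum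

/-! ## §1  `|2| < 1` at a dyadic place -/

/-- At a place where `2` is not a unit of the valuation ring (`Valued` spelling of `𝒪[K]`), `|2| < 1`. [cite: Rogawski1990, §4.9 p. 55] -/
theorem v_two_lt_one_of_not_isUnit_two {K : Type} [Field K] [Valued K ℤᵐ⁰] (h2 : ¬ IsUnit (2 : Valued.integer K)) : Valued.v (2 : K) < 1 := by
  by_contra h
  apply h2
  have hc : ((2 : Valued.integer K) : K) = 2 := by norm_cast
  have hle : Valued.v ((2 : Valued.integer K) : K) ≤ 1 := (2 : Valued.integer K).2
  have h1 : Valued.v ((2 : Valued.integer K) : K) = 1 := le_antisymm hle (by rw [hc]; exact not_lt.mp h)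
  have hu : IsUnit ((2 : Valued.integer K) : K) := by
    rw [isUnit_iff_ne_zero]
    intro h0
    rw [h0, map_zero] at h1
    exact zero_ne_one h1
  exact Valuation.Integers.isUnit_of_one (Valuation.integer.integers (Valued.v : Valuation K ℤᵐ⁰)) hu h1

/-! ## §2  THE (R-15) TWIN OF `stub_rows_unit0`, HYPOTHESIS FORM -/

/-- **THE THREE POPULATION ROWS OF THE TYPE-0 ANCHOR `1_K` AT EVERY WILD PLACE, FROM THE THREE UNIT EXPORTS** — `PieceRowsWild gselStar 0` (the statement of the tier-0 stub
`F0P3cDyRamFourFrame.stub_rows_unit0` TOKEN FOR TOKEN) from `hU3 : FourFrameLawsWildOfRecordR2 omegaR` (U3), `hDH : HSideAnchorRowsR depthOfRecord tauOfRecord 0` (U2H unit 0) and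
`hDG : AnchorCountDictionary 0` (U2G): place by place, ★ #11S `anchorRows_of_fourFrameLawsS shiftR` at the RAISED threshold `N₀' d' := max (depthOfRecord d') (2 d' − 1 + t_E)` of the ★
DEEP-THRESHOLD BRIDGE (laws from `hU3` in ★ №1-R's currency, `Ω ≡ 1` there; (D-CΔ) at any threshold; `hDH` weakened antitonically), at the root anchor `𝒪_w³ ∕ K ∕ 𝟙_K = gselStar 0`.
[cite: Rogawski1990, §4.9 Prop. 4.9.1 p. 55; §8.1 Prop. 8.1.2 p. 114] [cite: LanglandsShelstad1987, §1.3, §3] [cite: Kottwitz1986BaseChangeUnits, §1 pp. 240–241] -/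
theorem pieceRowsWild_gselStar_zero_of (hU3 : FourFrameLawsWildOfRecordR2 omegaR) (hDH : HSideAnchorRowsR depthOfRecord tauOfRecord 0)
    (hDG : AnchorCountDictionary 0) : PieceRowsWild gselStar 0 := by
  intro L _i1 _i2 _i3 v w hw he h2 ϖ hϖ _i4 _i5 _i6 _i7 _i8 _i9 _i10 _i11 μ hμu hμω νH _i12 _i13 νG₃ _i14 _i15 mH mG₃ hmH hmG
  haveI : Fintype (Valued.ResidueField (w.1.adicCompletion L)) := Fintype.ofFinite _
  -- the datum of the place and the dyadic fence
  obtain ⟨d, tE, hD⟩ := exists_isRamifiedQuadraticDatum_of_placesOver L w hw he ϖ hϖ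
  have hv2 : Valued.v (2 : w.1.adicCompletion L) < 1 :=
    v_two_lt_one_of_not_isUnit_two fun h => h2 (isUnit_two_valuationInteger_of_isUnit_two L w.1 h)
  -- a skew element: `δ := ϖ − σ_w ϖ`, `|δ| = |ϖ|^d ≠ 0`
  obtain ⟨hσσ, -, hvϖ, -, hdϖ, -, -⟩ := id hD
  have hδ : (galAdicCompletionMap (L := L) (IsCMField.complexConj L) hw) (ϖ - (galAdicCompletionMap (L := L) (IsCMField.complexConj L) hw) ϖ) =
      -(ϖ - (galAdicCompletionMap (L := L) (IsCMField.complexConj L) hw) ϖ) := by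
    rw [map_sub, hσσ]; ring
  have hδ0 : ϖ - (galAdicCompletionMap (L := L) (IsCMField.complexConj L) hw) ϖ ≠ 0 := by
    intro h0
    have h1 := hdϖ
    rw [h0, map_zero] at h1
    exact pow_ne_zero d (by rw [hvϖ]; exact WithZero.coe_ne_zero) h1.symm
  -- the three ★ №1-R cuts at the raised threshold, from U3's Ω-aware export (DEEP-THRESHOLD BRIDGE)
  obtain ⟨hS, hKA, hKS⟩ := lawsAtR_deep_of_ofRecordR2 hU3 (galAdicCompletionMap (L := L) (IsCMField.complexConj L) hw) ϖ d tE hv2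
  -- the root anchor: `𝒪_w³` is a type-0 vertex and `K` is its stabiliser under `ι_w`
  have hN : IsVertexLattice (galAdicCompletionMap (L := L) (IsCMField.complexConj L) hw) ϖ ((StdForm.antidiagonal 3).over (w.1.adicCompletion L)) 0
      (stdLattice (w.1.adicCompletion L) 3) :=
    isSelfDualLattice_stdLattice_three_of_v hϖ
  have hKt : ∀ u : ((UnitaryGroup.cmDatum L 3 (Matrix.of fun i j : Fin 3 => if i.val + j.val + 1 = 3 then (1 : L) else 0)).Local v),
      u ∈ cmLocalIntegralLevel L 3 (Matrix.of fun i j : Fin 3 => if i.val + j.val + 1 = 3 then (1 : L) else 0) v ↔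
        mapGL ((localNonsplitEquiv (IsCMField.complexConj L) (Matrix.of fun i j : Fin 3 => if i.val + j.val + 1 = 3 then (1 : L) else 0) (IsCMField.complexConj_ne_one L) w hw u :
          ↥(unitaryGroupOfForm (galAdicCompletionMap (L := L) (IsCMField.complexConj L) hw) (placeForm (Matrix.of fun i j : Fin 3 => if i.val + j.val + 1 = 3 then (1 : L) else 0) w.1))) : GL (Fin 3) (w.1.adicCompletion L))
          (stdLattice (w.1.adicCompletion L) 3) = stdLattice (w.1.adicCompletion L) 3 :=
    fun u => (mem_localIntegralLevel_iff_of_smul_eq (IsCMField.complexConj L) 3 (Matrix.of fun i j : Fin 3 => if i.val + j.val + 1 = 3 then (1 : L) else 0) (IsCMField.complexConj_ne_one L) w hw u).trans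
      (mapGL_stdLattice_eq_iff_mem_glInt _).symm
  -- ★ #11S at the raised threshold, root anchor, `g := gselStar 0 = 𝟙_K`
  exact anchorRows_of_fourFrameLawsS shiftR L w hw he h2 ϖ hϖ d tE hD (fun d' => max (depthOfRecord d') (2 * d' - 1 + tE)) tauOfRecord
    (ϖ - (galAdicCompletionMap (L := L) (IsCMField.complexConj L) hw) ϖ) hδ hδ0 hS hKA hKS 0 (Or.inl rfl) hDG
    (fourFrameTransferFactorS_any shiftR _) (hSideAnchorRowsR_deep_of_depthOfRecord tauOfRecord 0 tE hDH)
    μ hμu hμω νH νG₃ mH mG₃ hmH hmG (stdLattice (w.1.adicCompletion L) 3) hN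
    (cmLocalIntegralLevel L 3 (Matrix.of fun i j : Fin 3 => if i.val + j.val + 1 = 3 then (1 : L) else 0) v) hKt
    ((gselStar 0) L v w hw ϖ) rfl

end Summit.HodgeConjecture.HodgeConjecture.Cruxes.H413.F0P3cDyRamPieceRowsWildUnit0OfExports

end
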